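import Literature.Computability.AlgebraicComplexity.RectangularExponentSubadditivity
import Literature.Computability.AlgebraicComplexity.RectangularExponentSymmetry
import HarnessLib

/-!
# The information lower bound `ω(r, s, t) ≥ max(r+s, s+t, t+r)` and the blocking upper bound
`ω(r, s, t) ≤ r + s + t − (3 − ω)·min(r, s, t)` for the rectangular exponents — proved

Topic `Literature/Computability/AlgebraicComplexity`.  Huang–Pan 1998, §2 ("the exponents
`ω(r, s, t)`") at kernel grade, for the tree's rank-form rectangular exponents
`omegaRect K a b c = ω(a, b, c) = inf {β | R(⟨⌈n^a⌉, ⌈n^b⌉, ⌈n^c⌉⟩) = O(n^β)}`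
(`RectangularExponent.lean`), in ALL three slots and for ALL real arguments (the paper takes
non-negative rationals `r, s, t`; the tree's `⌈n^a⌉` convention makes every real triple meaningful,
and the proofs below never use a sign hypothesis unless stated):

* **(2.8), the information lower bound** (`HuangPan1998_eq_2_8`): "There is the straightforward
  (information) lower bound `ω(r, s, t) ≥ max[r+s, s+t, t+r]`" — the three flattenings
  `R(⟨k,m,n⟩) ≥ km, mn, kn` (Bläser 2013, Lemma 7.1 (2) with Lemma 5.5; `FlatteningBound.lean`)
  at the level of admissible exponents (`add_le_of_mem_rectAdmissibleExponents₁₂/₂₃/₁₃`) and of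
  the exponents (`add_le_omegaRect₁₂/₂₃/₁₃`).  Before this file the tree had the two one-slot
  instances `two_le_omegaRect_one_one : 2 ≤ ω(1,1,q)` and
  `add_one_le_omegaRect_one_mid_one : p + 1 ≤ ω(1,p,1)` only.
* **Lotti–Romani 1983, §2 (p. 174)**: "`f(x) ≥ max(2, x+1)`" for `f(x) = β(x,1,1)`, in all three
  placements (`LottiRomani1983_sec2_lower`, `max_two_add_one_le_omegaRect_one_mid_one`,
  `max_two_add_one_le_omegaRect_one_one`).
* **the blocking upper bound** printed after (2.5): "`M(m, n, p) = O(q^ω max(mn, np, pm) q^{−2})`,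
  `q = min(m, n, p)`, provided that `M(q,q,q) = O(q^ω)`" — in exponent form
  `ω(r, s, t) ≤ r + s + t − 3m + m·ω` for every `0 ≤ m ≤ r, s, t`
  (`HuangPan1998_omegaRect_le_blocking`), in particular for `m = min(r,s,t)`
  (`HuangPan1998_omegaRect_le_blocking_min`); here derived from Lotti–Romani subadditivity and
  positive homogeneity (`RectangularExponentSubadditivity.lean`) and the standard algorithm
  (`omegaRect_le_max`): `ω(r,s,t) ≤ ω(m,m,m) + ω(r−m, s−m, t−m) ≤ m·ω + (r+s+t−3m)`.
* the printed reductions of p. 262–263: `ω(r, r, r) = r·ω(1,1,1)` (`HuangPan1998_omegaRect_diag`) and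
  `ω(1, 1, t/r) = ω(r, r, t)/r` (`HuangPan1998_omegaRect_rrt`).
* consequences (our formalisation, same locators): the sandwich
  `r + s + t − min(r,s,t) ≤ ω(r,s,t) ≤ r + s + t − (3 − ω)·min(r,s,t)` for `r, s, t ≥ 0`
  (`sub_min_le_omegaRect`, `HuangPan1998_omegaRect_le_blocking_min`), whose width is
  `(ω − 2)·min(r,s,t)`; the EXACT values on the coordinate planes, `ω(r, s, t) = r + s` whenever
  `r, s ≥ 0 ≥ t` (`omegaRect_eq_add_of_nonpos₃/₂/₁`; (2.4) `M(m, n, 1) = mn` in exponent form),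
  `ω(0,0,0) = 0`; the crude bound `ω(1,1,k) ≤ 2 + (ω − 2)k` on `[0,1]`
  (`omegaRect_one_one_le_two_add_mul`); and the criterion
  `ω = 2 ↔ ∀ r s t ≥ 0, ω(r,s,t) = r + s + t − min(r,s,t)` (`omega_eq_two_iff_omegaRect_eq_sub_min`):
  the exponent of matrix multiplication is `2` iff every rectangular exponent meets the information
  bound.

Everything is proved; no definitions, no named facts.

## References

* X. Huang, V. Y. Pan, *Fast rectangular matrix multiplication and applications*, J. Complexity 14
  (1998) 257–299, §2: (2.4), (2.5) and the display following it, (2.7), (2.8), p. 262–263.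
  [HuangPan1998]
* G. Lotti, F. Romani, *On the asymptotic complexity of rectangular matrix multiplication*,
  Theoret. Comput. Sci. 23 (1983) 171–185, §2 (p. 174): `f(x) ≥ max(2, x+1)`. [LottiRomani1983]
* M. Bläser, *Fast Matrix Multiplication*, Theory of Computing Graduate Surveys 5 (2013),
  Lemma 5.5, Lemma 7.1 (2) (the flattening lower bounds). [Blaser2013]

## Design notes

* `ω`-statements are over `K : Type` with `[Field K]`, as in `RectangularExponentBounds.lean`
  (the flattening bounds need a field).
* The lower bounds hold for all real `r, s, t` (for a negative exponent `⌈n^a⌉ = 1 ≥ n^a` still).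
  The upper bounds need `0 ≤ m ≤ r, s, t` (homogeneity and the standard algorithm are stated on
  the non-negative orthant).
-/

noncomputable section

open Filter Asymptotics

namespace Literature.Computability.AlgebraicComplexity

section InformationBound

variable (K : Type) [Field K]

/-! ## Flattening at the level of admissible exponents -/

/-- If the defining rank function dominates `n^s` for every `n ≥ 1`, then every admissible exponent
of `(a, b, c)` is `≥ s` (otherwise `n^{s−β} ≤ C` eventually, while `n^{s−β} → ∞`). [folklore] -/
private theorem le_of_rpow_le_tensorRank {a b c s β : ℝ}
    (hs : ∀ n : ℕ, 1 ≤ n → (n : ℝ) ^ s ≤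
      (tensorRank (matMulTensor K (rectDim n a) (rectDim n b) (rectDim n c)) : ℝ))
    (hβ : β ∈ rectAdmissibleExponents K a b c) : s ≤ β := by
  by_contra hlt
  rw [not_le] at hlt
  obtain ⟨C, hC⟩ := isBigO_iff.1 hβ
  -- eventually `n ^ (s - β) ≤ C`
  have hev : ∀ᶠ n : ℕ in atTop, (n : ℝ) ^ (s - β) ≤ C := by
    filter_upwards [hC, eventually_ge_atTop 1] with n hn hn1
    have hn0 : (0 : ℝ) < n := by exact_mod_cast hn1
    rw [Real.norm_of_nonneg (Nat.cast_nonneg _),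
      Real.norm_of_nonneg (Real.rpow_nonneg (Nat.cast_nonneg _) _)] at hn
    rw [Real.rpow_sub hn0, div_le_iff₀ (Real.rpow_pos_of_pos hn0 _)]
    exact (hs n hn1).trans hn
  -- but `n ^ (s - β) → ∞`
  have hlim : Tendsto (fun n : ℕ => (n : ℝ) ^ (s - β)) atTop atTop :=
    (tendsto_rpow_atTop (by linarith)).comp tendsto_natCast_atTop_atTop
  obtain ⟨n, hn₁, hn₂⟩ := (hev.and (hlim.eventually_gt_atTop C)).exists
  exact absurd hn₁ (not_le.2 hn₂)

/-- `n^{a+b} = n^a n^b ≤ ⌈n^a⌉ ⌈n^b⌉` for `n ≥ 1`. [folklore] -/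
private theorem rpow_add_le_rectDim_mul {n : ℕ} (hn : 1 ≤ n) (a b : ℝ) :
    (n : ℝ) ^ (a + b) ≤ ((rectDim n a * rectDim n b : ℕ) : ℝ) := by
  have hn0 : (0 : ℝ) < n := by exact_mod_cast hn
  have ha : (n : ℝ) ^ a ≤ (rectDim n a : ℝ) := Nat.le_ceil _
  have hb : (n : ℝ) ^ b ≤ (rectDim n b : ℝ) := Nat.le_ceil _
  rw [Real.rpow_add hn0, Nat.cast_mul]
  exact mul_le_mul ha hb (Real.rpow_nonneg hn0.le _) (Nat.cast_nonneg _)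

/-- For `n ≥ 1` every rectangular dimension is non-zero. [folklore] -/
private theorem rectDim_neZero {n : ℕ} (hn : 1 ≤ n) (a : ℝ) : NeZero (rectDim n a) :=
  ⟨Nat.one_le_iff_ne_zero.1 (one_le_rectDim hn a)⟩

/-- **Flattening along the first two slots**: every admissible exponent `β` of `(a, b, c)` satisfies
`a + b ≤ β`, since `R(⟨⌈n^a⌉, ⌈n^b⌉, ⌈n^c⌉⟩) ≥ ⌈n^a⌉⌈n^b⌉ ≥ n^{a+b}` (Bläser 2013, Lemma 7.1 (2)
with Lemma 5.5) while `R = O(n^β)`; all real `a, b, c`. [cite: HuangPan1998, §2 eq. (2.8) (p. 262)] -/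
theorem add_le_of_mem_rectAdmissibleExponents₁₂ {a b c β : ℝ}
    (hβ : β ∈ rectAdmissibleExponents K a b c) : a + b ≤ β := by
  refine le_of_rpow_le_tensorRank K (fun n hn => ?_) hβ
  haveI := rectDim_neZero hn c
  exact (rpow_add_le_rectDim_mul hn a b).trans
    (by exact_mod_cast mul_le_tensorRank_matMulTensor_left K (rectDim n a) (rectDim n b) (rectDim n c))

/-- **Flattening along the last two slots**: every admissible exponent `β` of `(a, b, c)` satisfies
`b + c ≤ β` (`R(⟨k, m, n⟩) ≥ mn`). [cite: HuangPan1998, §2 eq. (2.8) (p. 262)] -/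
theorem add_le_of_mem_rectAdmissibleExponents₂₃ {a b c β : ℝ}
    (hβ : β ∈ rectAdmissibleExponents K a b c) : b + c ≤ β := by
  refine le_of_rpow_le_tensorRank K (fun n hn => ?_) hβ
  haveI := rectDim_neZero hn a
  exact (rpow_add_le_rectDim_mul hn b c).trans
    (by exact_mod_cast mul_le_tensorRank_matMulTensor_right K (rectDim n a) (rectDim n b) (rectDim n c))

/-- **Flattening along the outer slots**: every admissible exponent `β` of `(a, b, c)` satisfies
`a + c ≤ β` (`R(⟨k, m, n⟩) ≥ kn`, the output slices). [cite: HuangPan1998, §2 eq. (2.8) (p. 262)] -/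
theorem add_le_of_mem_rectAdmissibleExponents₁₃ {a b c β : ℝ}
    (hβ : β ∈ rectAdmissibleExponents K a b c) : a + c ≤ β := by
  refine le_of_rpow_le_tensorRank K (fun n hn => ?_) hβ
  haveI := rectDim_neZero hn b
  exact (rpow_add_le_rectDim_mul hn a c).trans
    (by exact_mod_cast mul_le_tensorRank_matMulTensor K (rectDim n a) (rectDim n b) (rectDim n c))

/-- The information bound at the level of admissible exponents: `max(r+s, s+t, t+r) ≤ β` for every
admissible exponent `β` of `(r, s, t)` (all real `r, s, t`). [cite: HuangPan1998, §2 eq. (2.8) (p. 262)] -/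
theorem max_add_le_of_mem_rectAdmissibleExponents {r s t β : ℝ}
    (hβ : β ∈ rectAdmissibleExponents K r s t) : max (r + s) (max (s + t) (t + r)) ≤ β :=
  max_le (add_le_of_mem_rectAdmissibleExponents₁₂ K hβ)
    (max_le (add_le_of_mem_rectAdmissibleExponents₂₃ K hβ)
      (by rw [add_comm]; exact add_le_of_mem_rectAdmissibleExponents₁₃ K hβ))

/-! ## The information lower bound (2.8) for the exponents -/

/-- **`r + s ≤ ω(r, s, t)`** for every field and all real `r, s, t`.
[cite: HuangPan1998, §2 eq. (2.8) (p. 262)] -/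
theorem add_le_omegaRect₁₂ (r s t : ℝ) : r + s ≤ omegaRect K r s t :=
  le_csInf (rectAdmissibleExponents_nonempty K r s t)
    fun _ hβ => add_le_of_mem_rectAdmissibleExponents₁₂ K hβ

/-- **`s + t ≤ ω(r, s, t)`** for every field and all real `r, s, t`.
[cite: HuangPan1998, §2 eq. (2.8) (p. 262)] -/
theorem add_le_omegaRect₂₃ (r s t : ℝ) : s + t ≤ omegaRect K r s t :=
  le_csInf (rectAdmissibleExponents_nonempty K r s t)
    fun _ hβ => add_le_of_mem_rectAdmissibleExponents₂₃ K hβ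

/-- **`r + t ≤ ω(r, s, t)`** for every field and all real `r, s, t`.
[cite: HuangPan1998, §2 eq. (2.8) (p. 262)] -/
theorem add_le_omegaRect₁₃ (r s t : ℝ) : r + t ≤ omegaRect K r s t :=
  le_csInf (rectAdmissibleExponents_nonempty K r s t)
    fun _ hβ => add_le_of_mem_rectAdmissibleExponents₁₃ K hβ

/-- **Huang–Pan 1998, (2.8): the information lower bound `ω(r, s, t) ≥ max[r+s, s+t, t+r]`** ("There
is the straightforward (information) lower bound"), here for the rank-form exponent over every field
and for all real `r, s, t`. [cite: HuangPan1998, §2 eq. (2.8) (p. 262)] -/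
theorem HuangPan1998_eq_2_8 (r s t : ℝ) : max (r + s) (max (s + t) (t + r)) ≤ omegaRect K r s t :=
  le_csInf (rectAdmissibleExponents_nonempty K r s t)
    fun _ hβ => max_add_le_of_mem_rectAdmissibleExponents K hβ

/-- The information bound with the complementary pair: `r + s + t − min(r, s, t) ≤ ω(r, s, t)`
(the pair sum omitting a smallest exponent is one of the three pair sums). All real `r, s, t`.
[cite: HuangPan1998, §2 eq. (2.8) (p. 262)] -/
theorem sub_min_le_omegaRect (r s t : ℝ) : r + s + t - min r (min s t) ≤ omegaRect K r s t := by
  rcases min_choice s t with h | h <;> rcases min_choice r (min s t) with h' | h' <;> rw [h'] <;>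
    try rw [h]
  · linarith [add_le_omegaRect₂₃ K r s t]
  · linarith [add_le_omegaRect₁₃ K r s t]
  · linarith [add_le_omegaRect₂₃ K r s t]
  · linarith [add_le_omegaRect₁₂ K r s t]

/-! ## Lotti–Romani 1983, §2: `f(x) ≥ max(2, x + 1)` in all three placements -/

/-- **Lotti–Romani 1983, §2 (p. 174): `f(x) ≥ max(2, x+1)`** for `f(x) = β(x, 1, 1)`, the exponent of
`⌈n^x⌉ × n` by `n × n` products — the information bound at `(x, 1, 1)`; every field, every real `x`.
[cite: LottiRomani1983, §2 (p. 174)] -/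
theorem LottiRomani1983_sec2_lower (x : ℝ) : max 2 (x + 1) ≤ omegaRect K x 1 1 :=
  max_le (by have h := add_le_omegaRect₂₃ K x 1 1; norm_num at h; exact h) (add_le_omegaRect₁₂ K x 1 1)

/-- `max(2, x+1) ≤ ω(1, x, 1)` (Lotti–Romani's bound in the middle placement, `f(x) = β(1,x,1)` by
(2.7); the tree's `two_le_omegaRect_one_mid_one` and `add_one_le_omegaRect_one_mid_one` combined).
[cite: LottiRomani1983, §2 (p. 174)] -/
theorem max_two_add_one_le_omegaRect_one_mid_one (x : ℝ) : max 2 (x + 1) ≤ omegaRect K 1 x 1 :=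
  max_le (by have h := add_le_omegaRect₁₃ K 1 x 1; norm_num at h; exact h)
    (by rw [add_comm]; exact add_le_omegaRect₁₂ K 1 x 1)

/-- `max(2, x+1) ≤ ω(1, 1, x)` (Lotti–Romani's bound in the last placement, `f(x) = β(1,1,x)`; for
`x ≥ 1` this is the flattening bound `ω(1,1,x) ≥ x + 1` along the `n × ⌈n^x⌉` output; the same
statement is proved problem-side as `Summit.MatrixMultiplication.MatrixMultiplication.Theorems.
max_two_add_one_le_omegaRect` in `SoloInformedTwoSidedLadder.lean`, from the two one-slot bounds).
[cite: LottiRomani1983, §2 (p. 174)] -/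
theorem max_two_add_one_le_omegaRect_one_one (x : ℝ) : max 2 (x + 1) ≤ omegaRect K 1 1 x :=
  max_le (by have h := add_le_omegaRect₁₂ K 1 1 x; norm_num at h; exact h)
    (by rw [add_comm]; exact add_le_omegaRect₂₃ K 1 1 x)

/-! ## Homogeneity reductions printed on p. 262–263 -/

/-- **`ω(r, r, r) = r·ω(1, 1, 1) = r·ω`** (`r ≥ 0`): square products of size `n^r` ("Computing its
bilinear complexity is reduced to computing the exponent `ω(r,r,r) = r·ω(1,1,1)`, by homogeneity").
[cite: HuangPan1998, §2 (p. 262)] -/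
theorem HuangPan1998_omegaRect_diag {r : ℝ} (hr : 0 ≤ r) : omegaRect K r r r = r * omega K := by
  have h := LottiRomani1983_homogeneous K hr zero_le_one zero_le_one zero_le_one
  rw [mul_one] at h
  rw [h, omegaRect_one_one_one]

/-- **`ω(r, r, t) = r·ω(1, 1, t/r)`** (`r > 0`, `t ≥ 0`): a square matrix times a rectangular one
("reduced to computing the exponent `ω(r, r, t)`, that is, to computing `ω(1, 1, t/r) = ω(r,r,t)/r`, by
homogeneity"). [cite: HuangPan1998, §2 (p. 263)] -/
theorem HuangPan1998_omegaRect_rrt {r t : ℝ} (hr : 0 < r) (ht : 0 ≤ t) :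
    omegaRect K r r t = r * omegaRect K 1 1 (t / r) := by
  have h := LottiRomani1983_homogeneous K hr.le zero_le_one zero_le_one (div_nonneg ht hr.le)
  rw [mul_one, mul_div_cancel₀ t hr.ne'] at h
  exact h

/-! ## The blocking upper bound (display after (2.5)) -/

/-- **The blocking upper bound** `ω(r, s, t) ≤ (r + s + t − 3m) + m·ω` for every `0 ≤ m ≤ r, s, t`:
cut all three dimensions into blocks of size `n^m` and multiply the resulting
`⌈n^{r−m}⌉ × ⌈n^{s−m}⌉` by `⌈n^{s−m}⌉ × ⌈n^{t−m}⌉` block matrices naively — Huang–Pan's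
"`M(m, n, p) ≤ M(m/q, n/q, p/q) M(q, q, q)`" (2.5) with the standard algorithm for the first factor.
Here: subadditivity `ω(r,s,t) ≤ ω(m,m,m) + ω(r−m, s−m, t−m)` (Lotti–Romani), `ω(m,m,m) = m·ω`
and `ω(r−m, s−m, t−m) ≤ (r−m) + (s−m) + (t−m)`. [cite: HuangPan1998, §2 eq. (2.5) and the display following it (p. 261–262)] -/
theorem HuangPan1998_omegaRect_le_blocking {r s t m : ℝ} (hm : 0 ≤ m) (hr : m ≤ r) (hs : m ≤ s)
    (ht : m ≤ t) : omegaRect K r s t ≤ (r + s + t - 3 * m) + m * omega K := by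
  have h₁ := LottiRomani1983_subadditive K m m m (r - m) (s - m) (t - m)
  rw [add_sub_cancel, add_sub_cancel, add_sub_cancel] at h₁
  have h₂ : omegaRect K m m m = m * omega K := HuangPan1998_omegaRect_diag K hm
  have h₃ := omegaRect_le_max K (rectAdmissibleExponents_bddBelow K (r - m) (s - m) (t - m))
  rw [max_eq_left (sub_nonneg.2 hr), max_eq_left (sub_nonneg.2 hs), max_eq_left (sub_nonneg.2 ht)]
    at h₃
  linarith

/-- **Huang–Pan 1998, after (2.5): `M(m, n, p) = O(q^{ω−2} max(mn, np, pm))`, `q = min(m, n, p)`** —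
in exponent form `ω(r, s, t) ≤ r + s + t − (3 − ω)·min(r, s, t)` for `r, s, t ≥ 0` (equivalently
`≤ max(r+s, s+t, t+r) + (ω − 2)·min(r, s, t)`). [cite: HuangPan1998, §2 eq. (2.5) and the display following it (p. 261–262)] -/
theorem HuangPan1998_omegaRect_le_blocking_min {r s t : ℝ} (hr : 0 ≤ r) (hs : 0 ≤ s) (ht : 0 ≤ t) :
    omegaRect K r s t ≤ r + s + t - (3 - omega K) * min r (min s t) := by
  have h := HuangPan1998_omegaRect_le_blocking K (le_min hr (le_min hs ht)) (min_le_left _ _)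
    ((min_le_right _ _).trans (min_le_left _ _)) ((min_le_right _ _).trans (min_le_right _ _))
  linarith

/-- The crude bound **`ω(1, 1, k) ≤ 2 + (ω − 2)·k` for `0 ≤ k ≤ 1`** (blocks of size `n^k`:
`(m, n, p) = (n, n, n^k)`, `q = n^k`). [cite: HuangPan1998, §2 eq. (2.5) and the display following it (p. 261–262)] -/
theorem omegaRect_one_one_le_two_add_mul {k : ℝ} (hk₀ : 0 ≤ k) (hk₁ : k ≤ 1) :
    omegaRect K 1 1 k ≤ 2 + (omega K - 2) * k := by
  have h := HuangPan1998_omegaRect_le_blocking K hk₀ hk₁ hk₁ le_rfl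
  linarith

/-! ## Consequences: exact values on the coordinate planes; `ω = 2` and the information bound -/

/-- **Exact values on a coordinate plane: `ω(r, s, t) = r + s` whenever `r, s ≥ 0 ≥ t`** — the
information bound `r + s ≤ ω(r,s,t)` meets the standard algorithm `ω(r,s,t) ≤ r⁺ + s⁺ + t⁺ = r + s`
(for `t = 0` these are the matrix–vector formats `⟨⌈n^r⌉, ⌈n^s⌉, 1⟩` of (2.4), `M(m, n, 1) = mn`).
[cite: HuangPan1998, §2 eq. (2.4) and (2.8) (p. 261–262)] -/
theorem omegaRect_eq_add_of_nonpos₃ {r s t : ℝ} (hr : 0 ≤ r) (hs : 0 ≤ s) (ht : t ≤ 0) :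
    omegaRect K r s t = r + s := by
  refine le_antisymm ?_ (add_le_omegaRect₁₂ K r s t)
  have h := omegaRect_le_max K (rectAdmissibleExponents_bddBelow K r s t)
  rwa [max_eq_left hr, max_eq_left hs, max_eq_right ht, add_zero] at h

/-- `ω(r, s, t) = r + t` whenever `r, t ≥ 0 ≥ s` (e.g. outer products `⟨⌈n^r⌉, 1, ⌈n^t⌉⟩` for
`s = 0`). [cite: HuangPan1998, §2 eq. (2.4) and (2.8) (p. 261–262)] -/
theorem omegaRect_eq_add_of_nonpos₂ {r s t : ℝ} (hr : 0 ≤ r) (hs : s ≤ 0) (ht : 0 ≤ t) :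
    omegaRect K r s t = r + t := by
  rw [omegaRect_swap₂₃, omegaRect_eq_add_of_nonpos₃ K hr ht hs]

/-- `ω(r, s, t) = s + t` whenever `s, t ≥ 0 ≥ r` (vector–matrix formats `⟨1, ⌈n^s⌉, ⌈n^t⌉⟩` for
`r = 0`). [cite: HuangPan1998, §2 eq. (2.4) and (2.8) (p. 261–262)] -/
theorem omegaRect_eq_add_of_nonpos₁ {r s t : ℝ} (hr : r ≤ 0) (hs : 0 ≤ s) (ht : 0 ≤ t) :
    omegaRect K r s t = s + t := by
  rw [omegaRect_rotate, omegaRect_eq_add_of_nonpos₃ K hs ht hr]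

/-- `ω(0, 0, 0) = 0`. [cite: HuangPan1998, §2 eq. (2.4) and (2.8) (p. 261–262)] -/
theorem omegaRect_zero_zero_zero : omegaRect K 0 0 0 = 0 := by
  have h := omegaRect_eq_add_of_nonpos₃ K (le_refl (0 : ℝ)) (le_refl (0 : ℝ)) (le_refl (0 : ℝ))
  rwa [add_zero] at h

/-- **If `ω = 2` then every rectangular exponent meets the information bound**:
`ω(r, s, t) = r + s + t − min(r, s, t) = max(r+s, s+t, t+r)` for all `r, s, t ≥ 0` (the sandwich
`r+s+t − min ≤ ω(r,s,t) ≤ r+s+t − (3−ω)·min` collapses). [cite: HuangPan1998, §2 eq. (2.5)–(2.8) (p. 261–262)] -/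
theorem omegaRect_eq_sub_min_of_omega_eq_two (hω : omega K = 2) {r s t : ℝ} (hr : 0 ≤ r)
    (hs : 0 ≤ s) (ht : 0 ≤ t) : omegaRect K r s t = r + s + t - min r (min s t) := by
  refine le_antisymm ?_ (sub_min_le_omegaRect K r s t)
  have h := HuangPan1998_omegaRect_le_blocking_min K hr hs ht
  rw [hω] at h
  linarith

/-- **`ω = 2` if and only if `ω(r, s, t) = r + s + t − min(r, s, t)` for all `r, s, t ≥ 0`** — the
exponent of matrix multiplication is `2` exactly when every rectangular exponent equals its information
lower bound (`←`: the case `r = s = t = 1`, `ω(1,1,1) = ω`). [cite: HuangPan1998, §2 eq. (2.5)–(2.8) (p. 261–262)] -/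
theorem omega_eq_two_iff_omegaRect_eq_sub_min :
    omega K = 2 ↔ ∀ r s t : ℝ, 0 ≤ r → 0 ≤ s → 0 ≤ t →
      omegaRect K r s t = r + s + t - min r (min s t) := by
  refine ⟨fun hω r s t hr hs ht => omegaRect_eq_sub_min_of_omega_eq_two K hω hr hs ht, fun h => ?_⟩
  have h1 := h 1 1 1 zero_le_one zero_le_one zero_le_one
  rw [omegaRect_one_one_one] at h1
  norm_num at h1
  exact h1

/-- The width of the sandwich: **`ω(r, s, t) − (r + s + t − min(r,s,t)) ≤ (ω − 2)·min(r, s, t)`** for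
`r, s, t ≥ 0` — the rectangular exponents are determined by `ω` up to an error proportional to the
smallest format exponent. [cite: HuangPan1998, §2 eq. (2.5)–(2.8) (p. 261–262)] -/
theorem omegaRect_sub_information_le {r s t : ℝ} (hr : 0 ≤ r) (hs : 0 ≤ s) (ht : 0 ≤ t) :
    omegaRect K r s t - (r + s + t - min r (min s t)) ≤ (omega K - 2) * min r (min s t) := by
  have h := HuangPan1998_omegaRect_le_blocking_min K hr hs ht
  linarith

end InformationBound

end Literature.Computability.AlgebraicComplexity
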